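import Mathlib.MeasureTheory.Integral.IntervalIntegral.FundThmCalculus
import Literature.Geometry.Lorentzian.KerrSchildWaveOperatorWKB
import Literature.Geometry.Lorentzian.GaussianBeamDefect
import HarnessLib

/-!
# The amplitude of the explicit Gaussian beam: the transport equation along the curve
(trunk G08 = T-LORENTZ, geometric optics; namespace `Literature.Geometry.Lorentzian.GaussianBeam`)

Sbierski, Anal. PDE 8 (2015), §3, (3.5)–(3.6) (= arXiv:1311.2477v2 §2.2, (2.10)–(2.11) and
p. 14): once the phase `φ` satisfies the eikonal equation to second order along `γ`, the term of
order `λ` of `□(a e^{iλφ})`, namely `2 grad φ(a) + □φ · a`, is required to vanish along `γ`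
((3.10)), which is a linear **transport ODE** for `a|_γ`: "`a(γ(s))` is determined by
`2 grad φ(a) + □φ · a = 0` along `γ` and `a(γ(0))`" (arXiv p. 14).

In the time-graph parametrisation `X(t) = (t, c(t))` of `GaussianBeamDefect.lean`
(`𝔾(X) P = κ Ẋ`, `κ > 0`), `grad φ|_X = κ Ẋ`, so for an amplitude depending only on time near the
curve, `a(x) = A₀(x⁰)`, the condition reads `2κ Ȧ₀ + b A₀ = 0` with `b(t) = □φ(X(t))`, solved by
`A₀(t) = exp(−∫₀ᵗ b/(2κ))`. This file:

* `waveOperatorC_expand` — the product rule `□_G F = ∑ (∂_μ G^{μν}) ∂_νF + G^{μν} ∂_μ∂_νF` for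
  the complexified divergence-form operator `KerrSchild.waveOperatorC` of
  `KerrSchildWaveOperatorWKB.lean` (`C^∞` data on an open set);
* `dC_phase`, `fderiv_dC_phase`, `symbolC_phase`, `waveOperatorC_phase` — the derivatives of the
  explicit phase entering it (`∂φ = dphase`, `∂∂φ = ddphase`, `s(dφ, dφ) = defect`);
* `opTrace`, `waveOperatorC_phase_curve` — **`□φ(X(t)) = b(t) := ∑ (∂_μ g^{μν})(X) P_ν + g^{μν}(X) M_{μν}`**
  (jets `∂φ|_X = P`, `∂∂φ|_X = M`);
* `ampCore`, `hasDerivAt_ampCore`, `ampCore_transport`, `contDiffOn_ampCore` — the solution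
  `A₀ = exp(−∫₀ᵗ q)` of `Ȧ₀ = −q A₀`, `A₀(0) = 1`, its smoothness, and with `q = b/(2κ)` the
  transport ODE `2κ Ȧ₀ + b A₀ = 0`; `deriv_normSq_ampCore` — its real form
  `κ (|A₀|²)˙ + Re(b) |A₀|² = 0` (Sbierski's (firstcons), arXiv p. 16);
* `transport_curve_eq_zero` — **the order-`λ` coefficient `2 s(dφ, da) + a □φ` of
  `□(a e^{iλφ})` (`KerrSchild.waveOperatorC_mul_cexp_of_symm`) vanishes at `X(t)`** for any
  amplitude that agrees with `x ↦ A₀(x⁰)` near `X(t)`.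

## References

* J. Sbierski, *Characterisation of the energy of Gaussian beams on Lorentzian manifolds: with
  applications to black hole spacetimes*, Anal. PDE 8 (2015) 1379–1420, §3 (3.5), (3.6), (3.10);
  arXiv:1311.2477v2 §2.2 (2.10), (2.11), p. 14, p. 16 (key `Sbierski2015`).
-/

noncomputable section

open Set Filter Complex MeasureTheory intervalIntegral
open scoped ContDiff Topology

namespace Literature.Geometry.Lorentzian

namespace GaussianBeam

open KerrSchild

/-! ### The product-rule expansion of the complexified operator -/

section Expand

variable (G : E4 → Fin 4 → Fin 4 → ℝ) {U : Set E4} (hU : IsOpen U)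
  (hG : ∀ μ ν, ContDiffOn ℝ ∞ (fun x ↦ G x μ ν) U)
include hU

/-- Coordinate derivatives of a `C^∞` function are `C^∞` (on an open set). [folklore] -/
theorem contDiffOn_dC {F : E4 → ℂ} (hF : ContDiffOn ℝ ∞ F U) (ν : Fin 4) :
    ContDiffOn ℝ ∞ (fun y ↦ dC F y ν) U :=
  (hF.fderiv_of_isOpen hU le_rfl).clm_apply contDiffOn_const

include hG in
/-- **`□_G F = ∑ (∂_μ G^{μν}) ∂_ν F + G^{μν} ∂_μ∂_ν F`** (product rule) for the complexified
divergence-form operator, `C^∞` data on an open set; the first factor is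
`GaussianBeam.dG G x μ μ ν`. [cite: Sbierski2015, §3 (3.1)] -/
theorem waveOperatorC_expand {F : E4 → ℂ} (hF : ContDiffOn ℝ ∞ F U) {x : E4} (hx : x ∈ U) :
    waveOperatorC G F x = ∑ μ : Fin 4, ∑ ν : Fin 4,
      ((dG G x μ μ ν : ℂ) * dC F x ν +
        (G x μ ν : ℂ) * fderiv ℝ (fun y ↦ dC F y ν) x (E4.basisVector μ)) := by
  unfold waveOperatorC
  refine Finset.sum_congr rfl fun μ _ ↦ ?_
  have hxU : U ∈ 𝓝 x := hU.mem_nhds hx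
  have hGd : ∀ ν, HasFDerivAt (fun y ↦ (G y μ ν : ℂ))
      (Complex.ofRealCLM.comp (fderiv ℝ (fun y ↦ G y μ ν) x)) x := fun ν ↦
    Complex.ofRealCLM.hasFDerivAt.comp x
      (((hG μ ν).contDiffAt hxU).differentiableAt (by simp)).hasFDerivAt
  have hDd : ∀ ν, DifferentiableAt ℝ (fun y ↦ dC F y ν) x := fun ν ↦
    ((contDiffOn_dC hU hF ν).contDiffAt hxU).differentiableAt (by simp)
  have h : HasFDerivAt (fun y ↦ ∑ ν, (G y μ ν : ℂ) * dC F y ν) _ x :=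
    HasFDerivAt.fun_sum (u := Finset.univ) fun ν (_ : ν ∈ Finset.univ) ↦
      (hGd ν).mul (hDd ν).hasFDerivAt
  rw [h.fderiv, sum_apply]
  refine Finset.sum_congr rfl fun ν _ ↦ ?_
  simp only [add_apply, smul_apply, smul_eq_mul, ContinuousLinearMap.comp_apply,
    Complex.ofRealCLM_apply, dG]
  ring

end Expand

/-! ### The explicit phase in the operator -/

section PhaseOp

variable (G : E4 → Fin 4 → Fin 4 → ℝ) (P : ℝ → Fin 4 → ℝ) (M : ℝ → Fin 4 → Fin 4 → ℂ) (c : ℝ → E3)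
  {J : Set ℝ} (hJ : IsOpen J) (hP : ∀ μ, ContDiffOn ℝ ∞ (fun t ↦ P t μ) J)
  (hM : ∀ μ ν, ContDiffOn ℝ ∞ (fun t ↦ M t μ ν) J) (hc : ∀ i, ContDiffOn ℝ ∞ (fun t ↦ c t i) J)
include hJ hP hM hc

/-- `∂_νφ = dphase` on the slab. [cite: Sbierski2015, §3 (3.12)] -/
theorem dC_phase {x : E4} (hx : x 0 ∈ J) (ν : Fin 4) : dC (phase P M c) x ν = dphase P M c ν x :=
  fderiv_phase hJ hP hM hc hx ν

/-- `∂φ = dphase` as functions, near a point of the slab. [cite: Sbierski2015, §3 (3.12)] -/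
theorem dC_phase_eventuallyEq {x : E4} (hx : x 0 ∈ J) (ν : Fin 4) :
    (fun y ↦ dC (phase P M c) y ν) =ᶠ[𝓝 x] dphase P M c ν := by
  filter_upwards [(isOpen_slab hJ).mem_nhds hx] with y hy using fderiv_phase hJ hP hM hc hy ν

/-- `∂_μ∂_νφ = ddphase` on the slab. [cite: Sbierski2015, §3 (3.12)] -/
theorem fderiv_dC_phase {x : E4} (hx : x 0 ∈ J) (μ ν : Fin 4) :
    fderiv ℝ (fun y ↦ dC (phase P M c) y ν) x (E4.basisVector μ) = ddphase P M c μ ν x := by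
  rw [(dC_phase_eventuallyEq P M c hJ hP hM hc hx ν).fderiv_eq, fderiv_dphase hJ hP hM hc hx]

/-- **`s(dφ, dφ) = defect`**: the eikonal quantity of the WKB identity is the defect of
`GaussianBeamDefect.lean`. [cite: Sbierski2015, §3 (3.1), (3.9)] -/
theorem symbolC_phase {x : E4} (hx : x 0 ∈ J) :
    symbolC G x (dC (phase P M c) x) (dC (phase P M c) x) = defect G P M c x := by
  simp only [symbolC, defect, dC_phase P M c hJ hP hM hc hx]

/-- **`□φ = ∑ (∂_μ g^{μν}) ∂_νφ + g^{μν} ∂_μ∂_νφ`** for the explicit phase, at a point of `V` in the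
slab. [cite: Sbierski2015, §3 (3.1)] -/
theorem waveOperatorC_phase {V : Set E4} (hV : IsOpen V) (hG : ∀ μ ν, ContDiffOn ℝ ∞ (fun x ↦ G x μ ν) V)
    {x : E4} (hxV : x ∈ V) (hx : x 0 ∈ J) :
    waveOperatorC G (phase P M c) x = ∑ μ : Fin 4, ∑ ν : Fin 4,
      ((dG G x μ μ ν : ℂ) * dphase P M c ν x + (G x μ ν : ℂ) * ddphase P M c μ ν x) := by
  have hU : IsOpen (V ∩ {x : E4 | x 0 ∈ J}) := hV.inter (isOpen_slab hJ)
  rw [waveOperatorC_expand G hU (fun μ ν ↦ (hG μ ν).mono inter_subset_left)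
    ((contDiffOn_phase hP hM hc).mono inter_subset_right) ⟨hxV, hx⟩]
  refine Finset.sum_congr rfl fun μ _ ↦ Finset.sum_congr rfl fun ν _ ↦ ?_
  rw [dC_phase P M c hJ hP hM hc hx, fderiv_dC_phase P M c hJ hP hM hc hx]

omit hJ hP hM hc in
/-- **The transport coefficient** `b(t) = □φ(X(t)) = ∑ (∂_μ g^{μν})(X(t)) P_ν(t) + g^{μν}(X(t)) M_{μν}(t)`.
[cite: Sbierski2015, §3 (3.10); arXiv v2 §2.2 p. 14] -/
def opTrace (t : ℝ) : ℂ :=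
  ∑ μ : Fin 4, ∑ ν : Fin 4, ((dG G (E4.ofTimeSpace t (c t)) μ μ ν : ℂ) * (P t ν : ℂ) +
    (G (E4.ofTimeSpace t (c t)) μ ν : ℂ) * M t μ ν)

/-- **`□φ(X(t)) = b(t)`** (the jets `∂φ|_X = P`, `∂∂φ|_X = M` of `GaussianBeamPhase.lean`).
[cite: Sbierski2015, §3 (3.10), (3.12)] -/
theorem waveOperatorC_phase_curve {V : Set E4} (hV : IsOpen V)
    (hG : ∀ μ ν, ContDiffOn ℝ ∞ (fun x ↦ G x μ ν) V)
    {t : ℝ} (ht : t ∈ J) (hXV : E4.ofTimeSpace t (c t) ∈ V)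
    (hPX : ∀ t ∈ J, P t 0 + ∑ i : Fin 3, P t i.succ * cdot c t i = 0)
    (hsymm : ∀ μ ν, M t μ ν = M t ν μ)
    (hMX : ∀ μ, ∑ ν : Fin 4, M t μ ν * (xdot c t ν : ℂ) = (pdot P t μ : ℂ)) :
    waveOperatorC G (phase P M c) (E4.ofTimeSpace t (c t)) = opTrace G P M c t := by
  have hx0 : (E4.ofTimeSpace t (c t)) 0 ∈ J := by simpa using ht
  have hMX' : ∀ μ, M t μ 0 + ∑ j : Fin 3, M t μ j.succ * (cdot c t j : ℂ) = (pdot P t μ : ℂ) := by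
    intro μ
    have h := hMX μ
    rw [Fin.sum_univ_succ] at h
    simpa [xdot] using h
  have hPX' := deriv_constraint_eq_zero hJ hP hc hPX ht
  rw [waveOperatorC_phase G P M c hJ hP hM hc hV hG hXV hx0, opTrace]
  refine Finset.sum_congr rfl fun μ _ ↦ Finset.sum_congr rfl fun ν _ ↦ ?_
  rw [dphase_curve P M c t (hPX t ht), ddphase_curve P M c t hsymm hMX' hPX']

end PhaseOp

/-! ### The amplitude `A₀ = exp(−∫₀ᵗ q)` -/

section Amplitude

variable (q : ℝ → ℂ) {J : Set ℝ}

/-- **The amplitude along the curve**: `A₀(t) = exp(−∫₀ᵗ q)`, the solution of `Ȧ₀ = −q A₀`,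
`A₀(0) = 1` (with `q = □φ(X)/(2κ)` this is the transport equation `2 grad φ(a) + □φ a = 0` along
the curve). [cite: Sbierski2015, §3 (3.10); arXiv v2 §2.2 p. 14] -/
def ampCore (t : ℝ) : ℂ := cexp (-∫ s in (0 : ℝ)..t, q s)

/-- `A₀(0) = 1`. [folklore] -/
theorem ampCore_zero : ampCore q 0 = 1 := by simp [ampCore]

/-- `A₀(t) ≠ 0`. [folklore] -/
theorem ampCore_ne_zero (t : ℝ) : ampCore q t ≠ 0 := Complex.exp_ne_zero _

variable (hJ : IsOpen J) (hJc : J.OrdConnected) (h0 : (0 : ℝ) ∈ J) (hq : ContDiffOn ℝ ∞ q J)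
include hJ hJc h0 hq

/-- The primitive `t ↦ ∫₀ᵗ q` has derivative `q(t)` at points of the interval `J`. [folklore] -/
theorem hasDerivAt_primitive {t : ℝ} (ht : t ∈ J) :
    HasDerivAt (fun u ↦ ∫ s in (0 : ℝ)..u, q s) (q t) t := by
  have hsub : uIcc 0 t ⊆ J := hJc.uIcc_subset h0 ht
  have hint : IntervalIntegrable q volume 0 t :=
    ((hq.continuousOn).mono hsub).intervalIntegrable
  have hcont : ContinuousAt q t := (hq.continuousOn.continuousWithinAt ht).continuousAt (hJ.mem_nhds ht)
  exact integral_hasDerivAt_right hint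
    ((hq.continuousOn).stronglyMeasurableAtFilter hJ _ ht) hcont

/-- **`Ȧ₀ = −q A₀`.** [cite: Sbierski2015, §3 (3.10)] -/
theorem hasDerivAt_ampCore {t : ℝ} (ht : t ∈ J) :
    HasDerivAt (ampCore q) (-q t * ampCore q t) t := by
  have h : HasDerivAt (ampCore q) (cexp (-∫ s in (0 : ℝ)..t, q s) * -q t) t :=
    (hasDerivAt_primitive q hJ hJc h0 hq ht).neg.cexp
  refine h.congr_deriv ?_
  simp only [ampCore]
  ring

/-- The primitive is `C^∞` on `J`. [folklore] -/
theorem contDiffOn_primitive : ContDiffOn ℝ ∞ (fun u ↦ ∫ s in (0 : ℝ)..u, q s) J := by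
  have hderiv : ∀ t ∈ J, deriv (fun u ↦ ∫ s in (0 : ℝ)..u, q s) t = q t := fun t ht ↦
    (hasDerivAt_primitive q hJ hJc h0 hq ht).deriv
  refine (contDiffOn_infty_iff_deriv_of_isOpen hJ).2 ⟨fun t ht ↦
    (hasDerivAt_primitive q hJ hJc h0 hq ht).differentiableAt.differentiableWithinAt, ?_⟩
  exact hq.congr hderiv

/-- **`A₀` is `C^∞` on `J`.** [folklore] -/
theorem contDiffOn_ampCore : ContDiffOn ℝ ∞ (ampCore q) J :=
  Complex.contDiff_exp.comp_contDiffOn (contDiffOn_primitive q hJ hJc h0 hq).neg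

/-- **The transport ODE** `2κ Ȧ₀ + b A₀ = 0` for `q = b/(2κ)`, `κ ≠ 0`. [cite: Sbierski2015, §3 (3.10)] -/
theorem ampCore_transport {b : ℝ → ℂ} {κ : ℝ → ℝ} (hqb : ∀ t ∈ J, q t = b t / (2 * κ t))
    (hκ : ∀ t ∈ J, κ t ≠ 0) {t : ℝ} (ht : t ∈ J) :
    2 * (κ t : ℂ) * deriv (ampCore q) t + b t * ampCore q t = 0 := by
  rw [(hasDerivAt_ampCore q hJ hJc h0 hq ht).deriv, hqb t ht]
  have hκ' : (κ t : ℂ) ≠ 0 := by exact_mod_cast hκ t ht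
  field_simp
  ring

/-- **The real form of the transport ODE**: `κ (|A₀|²)˙ = −Re(b) |A₀|²` (Sbierski, arXiv p. 16,
(firstcons): `grad φ(|a|²) = −Re(□φ)|a|²` along `γ`). [cite: Sbierski2015, §4 proof of Thm 4.1; arXiv v2 §3 p. 16] -/
theorem hasDerivAt_normSq_ampCore {b : ℝ → ℂ} {κ : ℝ → ℝ} (hqb : ∀ t ∈ J, q t = b t / (2 * κ t))
    (hκ : ∀ t ∈ J, κ t ≠ 0) {t : ℝ} (ht : t ∈ J) :
    HasDerivAt (fun u ↦ Complex.normSq (ampCore q u))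
      (-((b t).re / κ t) * Complex.normSq (ampCore q t)) t := by
  have hA := hasDerivAt_ampCore q hJ hJc h0 hq ht
  -- `|A|² = re² + im²`
  have hre : HasDerivAt (fun u ↦ (ampCore q u).re) (-q t * ampCore q t).re t :=
    (Complex.reCLM.hasFDerivAt.comp_hasDerivAt t hA)
  have him : HasDerivAt (fun u ↦ (ampCore q u).im) (-q t * ampCore q t).im t :=
    (Complex.imCLM.hasFDerivAt.comp_hasDerivAt t hA)
  have h := (hre.mul hre).add (him.mul him)
  have hfun : (fun u ↦ Complex.normSq (ampCore q u)) =
      fun u ↦ (ampCore q u).re * (ampCore q u).re + (ampCore q u).im * (ampCore q u).im := by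
    funext u; rw [Complex.normSq_apply]
  rw [hfun]
  refine h.congr_deriv ?_
  have hκt : κ t ≠ 0 := hκ t ht
  have h2 : ((2 : ℂ) * (κ t : ℂ)) = ((2 * κ t : ℝ) : ℂ) := by push_cast; ring
  rw [hqb t ht, h2, Complex.normSq_apply]
  simp only [Complex.mul_re, Complex.mul_im, Complex.neg_re, Complex.neg_im,
    Complex.div_ofReal_re, Complex.div_ofReal_im]
  field_simp
  ring

end Amplitude

/-! ### The transport term of `L(a e^{iλφ})` vanishes on the curve -/

section Transport

variable (𝔾 : E4 → Fin 4 → Fin 4 → ℝ) (P : ℝ → Fin 4 → ℝ) (M : ℝ → Fin 4 → Fin 4 → ℂ) (c : ℝ → E3)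

/-- The coordinate derivatives at `x` of an amplitude that is a function of time alone near `x`:
`∂_ν a(x) = δ_{ν0} Ȧ₀(x⁰)`. [folklore] -/
theorem dC_of_eventuallyEq_time {a : E4 → ℂ} {A₀ : ℝ → ℂ} {A₀' : ℂ} {x : E4}
    (ha : a =ᶠ[𝓝 x] fun y ↦ A₀ (y 0)) (hA : HasDerivAt A₀ A₀' (x 0)) (ν : Fin 4) :
    dC a x ν = if ν = 0 then A₀' else 0 := by
  have hcomp : HasFDerivAt (fun y : E4 ↦ A₀ (y 0))
      ((ContinuousLinearMap.smulRight (1 : ℝ →L[ℝ] ℝ) A₀').comp (E4.dx 0)) x :=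
    hA.hasFDerivAt.comp x (E4.dx 0).hasFDerivAt
  rw [dC, ha.fderiv_eq, hcomp.fderiv]
  by_cases hν : ν = 0
  · subst hν; simp [E4.basisVector]
  · simp [E4.basisVector, hν]

/-- **The transport term vanishes on the curve.** At `X(t)`, for the explicit phase (jets `P`,
`M`; `𝔾(X)P = κẊ`, `κ ≠ 0`) and any amplitude `a` that agrees near `X(t)` with `x ↦ A₀(x⁰)`,
`A₀ = ampCore q`, `q = □φ(X)/(2κ)` on `J`:
`2 ∑ g^{μν} ∂_μφ ∂_νa + a Lφ = 2κ Ȧ₀ + □φ(X) A₀ = 0` — the coefficient of `iλ e^{iλφ}` in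
`□(a e^{iλφ})` (`KerrSchild.waveOperatorC_mul_cexp_of_symm`), Sbierski's condition (3.10) at order `0`.
[cite: Sbierski2015, §3 (3.5), (3.10); arXiv v2 §2.2 (2.11), p. 14] -/
theorem transport_curve_eq_zero {J : Set ℝ} (hJ : IsOpen J) (hJc : J.OrdConnected) (h0 : (0 : ℝ) ∈ J)
    (hP : ∀ μ, ContDiffOn ℝ ∞ (fun t ↦ P t μ) J) (hM : ∀ μ ν, ContDiffOn ℝ ∞ (fun t ↦ M t μ ν) J)
    (hc : ∀ i, ContDiffOn ℝ ∞ (fun t ↦ c t i) J)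
    {V : Set E4} (hV : IsOpen V) (h𝔾 : ∀ μ ν, ContDiffOn ℝ ∞ (fun x ↦ 𝔾 x μ ν) V)
    (hGsymm : ∀ x μ ν, 𝔾 x μ ν = 𝔾 x ν μ)
    {κ : ℝ → ℝ} {q : ℝ → ℂ} (hq : ContDiffOn ℝ ∞ q J)
    (hqb : ∀ t ∈ J, q t = opTrace 𝔾 P M c t / (2 * κ t)) (hκ : ∀ t ∈ J, κ t ≠ 0)
    (hPX : ∀ t ∈ J, P t 0 + ∑ i : Fin 3, P t i.succ * cdot c t i = 0)
    {t : ℝ} (ht : t ∈ J) (hXV : E4.ofTimeSpace t (c t) ∈ V)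
    (hsymm : ∀ μ ν, M t μ ν = M t ν μ)
    (hMX : ∀ μ, ∑ ν : Fin 4, M t μ ν * (xdot c t ν : ℂ) = (pdot P t μ : ℂ))
    (hvel : ∀ μ, ∑ ν : Fin 4, 𝔾 (E4.ofTimeSpace t (c t)) μ ν * P t ν = κ t * xdot c t μ)
    {a : E4 → ℂ} (ha : a =ᶠ[𝓝 (E4.ofTimeSpace t (c t))] fun y ↦ ampCore q (y 0)) :
    2 * symbolC 𝔾 (E4.ofTimeSpace t (c t)) (dC (phase P M c) (E4.ofTimeSpace t (c t)))
        (dC a (E4.ofTimeSpace t (c t))) +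
      a (E4.ofTimeSpace t (c t)) * waveOperatorC 𝔾 (phase P M c) (E4.ofTimeSpace t (c t)) = 0 := by
  set X := E4.ofTimeSpace t (c t) with hX
  have hx0 : X 0 = t := by simp [hX]
  have hxJ : X 0 ∈ J := by simpa [hx0] using ht
  -- the ingredients at `X`
  have hA : HasDerivAt (ampCore q) (-q t * ampCore q t) (X 0) := by
    rw [hx0]; exact hasDerivAt_ampCore q hJ hJc h0 hq ht
  have hda : ∀ ν, dC a X ν = if ν = 0 then -q t * ampCore q t else 0 :=
    dC_of_eventuallyEq_time ha hA
  have hdφ : ∀ μ, dC (phase P M c) X μ = (P t μ : ℂ) := fun μ ↦ by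
    rw [dC_phase P M c hJ hP hM hc hxJ, hX, dphase_curve P M c t (hPX t ht)]
  have haX : a X = ampCore q t := by
    have := ha.self_of_nhds
    simpa [hx0] using this
  have hop : waveOperatorC 𝔾 (phase P M c) X = opTrace 𝔾 P M c t :=
    waveOperatorC_phase_curve 𝔾 P M c hJ hP hM hc hV h𝔾 ht hXV hPX hsymm hMX
  -- `∑_μ g^{μ0}(X) P_μ = κ`
  have hv0 : ∑ μ : Fin 4, (𝔾 X μ 0 : ℂ) * (P t μ : ℂ) = (κ t : ℂ) := by
    have h := congrArg ((↑) : ℝ → ℂ) (hvel 0)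
    push_cast at h
    simp only [xdot, Fin.cases_zero, Complex.ofReal_one, mul_one] at h
    rw [← h]
    exact Finset.sum_congr rfl fun μ _ ↦ by rw [hGsymm X μ 0]
  -- collapse the double sum on `ν = 0`
  have hsum : symbolC 𝔾 X (dC (phase P M c) X) (dC a X) =
      (-q t * ampCore q t) * ∑ μ : Fin 4, (𝔾 X μ 0 : ℂ) * (P t μ : ℂ) := by
    simp only [symbolC, hda, hdφ, mul_ite, mul_zero, Finset.sum_ite_eq', Finset.mem_univ, if_true,
      Finset.mul_sum]
    exact Finset.sum_congr rfl fun μ _ ↦ by ring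
  rw [hsum, hv0, haX, hop]
  have htr := ampCore_transport q hJ hJc h0 hq hqb hκ ht
  rw [(hasDerivAt_ampCore q hJ hJc h0 hq ht).deriv] at htr
  linear_combination htr

end Transport

end GaussianBeam

end Literature.Geometry.Lorentzian
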